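import Mathlib
import Literature.Geometry.DiscreteGeometry.TwoShellPatterns
import Literature.Geometry.DiscreteGeometry.TwoShellIntegerModel
import Literature.MathematicalPhysics.StatisticalMechanics.BarlowStacking
import Literature.MathematicalPhysics.StatisticalMechanics.HcpHomogeneous
import Summits.AtomisticToContinuum.Crystallization.Theorems.PhononSlackCertificatesNearFieldConvexityStubChartSites

/-!
# Crux `NashClassCertificates.NashNearField` (stmt-AtomisticToContinuum-16827), line `birth`,
# stub `stub_chartCore` — part 1: the PATTERN–TEMPLATE BRIDGE (clauses (i) and (ii))

The registered stub `stub_chartCore` (shared verbatim with the twin crux stmt-13958, line `Sketch`) asks,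
at a good particle with witnessed pattern `P ∈ {fccTwoShellPattern, hcpTwoShellPattern}`, for a linear
isometry `R` and a Hägg word `s` such that, among other things,

* (i)  every `v ∈ P` is `R` of a site `barlowPos 1 (√6/3) s m u w` of the ideal Barlow template, and
* (ii) every NON-ZERO template site of norm `≤ 3/2` is carried by `R` into `P`.

These two clauses are configuration-free.  This file proves them, for EVERY Hägg word `s`, with the
pattern dictated by the two letters around layer `0` (`fcc` iff `s (-1) = s 0`, `hcp` iff
`s (-1) ≠ s 0`) and with an EXPLICIT isometry: the cuboctahedral frame `cuboFrame` of
`TwoShellIntegerModel` when `s 0 = 1`, and `cuboFrame ∘ halfTurn` when `s 0 = -1`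
(`chartCoreBridge_fcc`, `chartCoreBridge_hcp`, `chartCoreBridge`, `chartCoreBridge_canonical`; explicit
forms `cuboFrame_barlowPos_mem_fcc/hcp`, `exists_site_eq_of_mem_fcc/hcp`,
`cuboFrame_halfTurn_barlowPos_mem_fcc/hcp`, `exists_site_halfTurn_eq_of_mem_fcc/hcp`).  No definition is
introduced.

Proof.  `cuboFrame (barlowPos 1 (√6/3) s m u w) = (barlowSiteInt m u w L)/√18`, `L = haggLabel s m`
(`cuboFrame_barlowPos`), and `12‖barlowPos …‖²` is the integer
`3(2u + w + L)² + (3w + L)² + 8m²` (`chartSites_normSq_eq`), so `‖·‖ ≤ 3/2` reads `N ≤ 27`, forcing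
`|m| ≤ 1`, where the letters are `L 0 = 0`, `L 1 = s 0`, `L (-1) = -s (-1)`.  For `s 0 = 1` the two
finite bookkeeping statements (sites of `N ≤ 27` ↦ `3 · (fccInt ∪ fccSecondShellInt)` resp.
`hcpInt ∪ hcpSecondShellInt`, and back) are integer identities checked by `decide`
(`bridgeCore_*`); `fccTwoShellPattern = (3·S)/√18` (`fccTwoShellPattern_eq_image`) and
`hcpTwoShellPattern = S/√18` finish.  For `s 0 = -1` the half-turn `(x,y,z) ↦ (-x,-y,z)` of the layer
frame negates the word: `halfTurn (barlowPos 1 h s m u w) = barlowPos 1 h (-s) m (-u) (-w)`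
(`halfTurn_barlowPos_eq`).
-/

noncomputable section

open Literature.MathematicalPhysics.StatisticalMechanics Literature.Geometry.DiscreteGeometry

namespace Summit.AtomisticToContinuum.Crystallization.Theorems.NashClassCertificatesNashNearField

open Summit.AtomisticToContinuum.Crystallization.Theorems.PhononSlackNearFieldConvexity
  (chartSites_normSq_eq chartSites_bounds)

/-! ### Letters of the three central layers -/

/-- The negated word is again a Hägg word. -/
theorem isHaggSeq_neg_seq {s : ℤ → ℤ} (hs : IsHaggSeq s) : IsHaggSeq (fun m => -s m) := fun i => by
  rcases hs i with h | h <;> simp [h]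

/-- **The half-turn negates the word**: `halfTurn (barlowPos a h s m u w) = barlowPos a h (-s) m (-u) (-w)`. -/
theorem halfTurn_barlowPos_eq (a h : ℝ) (s : ℤ → ℤ) (m u w : ℤ) :
    halfTurn (barlowPos a h s m u w) = barlowPos a h (fun k => -s k) m (-u) (-w) := by
  -- negating the word negates every letter (tree: `CLayerWitnessWitness.haggLabel_neg`, inlined)
  have hL : haggLabel (fun k => -s k) m = -haggLabel s m := by
    have hw : ∀ (m : ℤ) (n : ℕ), haggWindow (fun k => -s k) m n = -haggWindow s m n := fun m n => by
      simp [haggWindow, Finset.sum_neg_distrib]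
    unfold haggLabel
    split_ifs <;> simp [hw]
  ext l
  fin_cases l <;> simp [hL] <;> ring

/-! ### The integer cores (`decide`) -/

/-- fcc letters (`L m = m` on the central layers): every site with `12‖·‖² ≤ 27` is the origin or
`3 ·` a vector of the fcc integer model. -/
theorem bridgeCore_fcc_sites :
    ∀ m ∈ Finset.Icc (-1 : ℤ) 1, ∀ u ∈ Finset.Icc (-5 : ℤ) 5, ∀ w ∈ Finset.Icc (-3 : ℤ) 3,
      3 * (2 * u + w + m) ^ 2 + (3 * w + m) ^ 2 + 8 * m ^ 2 ≤ 27 →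
      (m = 0 ∧ u = 0 ∧ w = 0) ∨ ∃ t ∈ fccInt ∪ fccSecondShellInt,
        3 * t 0 = 3 * u + m + 2 * m ∧ 3 * t 1 = -(3 * u) - 3 * w - 2 * m + 2 * m ∧
          3 * t 2 = 3 * w + m + 2 * m := by
  decide

/-- fcc letters: every vector of the fcc integer model is (one third of) a central site. -/
theorem bridgeCore_fcc_labels :
    ∀ t ∈ fccInt ∪ fccSecondShellInt, ∃ m ∈ Finset.Icc (-1 : ℤ) 1, ∃ u ∈ Finset.Icc (-2 : ℤ) 2,
      ∃ w ∈ Finset.Icc (-2 : ℤ) 2,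
        3 * t 0 = 3 * u + m + 2 * m ∧ 3 * t 1 = -(3 * u) - 3 * w - 2 * m + 2 * m ∧
          3 * t 2 = 3 * w + m + 2 * m := by
  decide

/-- hcp letters (`L m = m²` on the central layers): every site with `12‖·‖² ≤ 27` is the origin or a
vector of the hcp integer model. -/
theorem bridgeCore_hcp_sites :
    ∀ m ∈ Finset.Icc (-1 : ℤ) 1, ∀ u ∈ Finset.Icc (-5 : ℤ) 5, ∀ w ∈ Finset.Icc (-3 : ℤ) 3,
      3 * (2 * u + w + m ^ 2) ^ 2 + (3 * w + m ^ 2) ^ 2 + 8 * m ^ 2 ≤ 27 →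
      (m = 0 ∧ u = 0 ∧ w = 0) ∨ ∃ t ∈ hcpInt ∪ hcpSecondShellInt,
        t 0 = 3 * u + m ^ 2 + 2 * m ∧ t 1 = -(3 * u) - 3 * w - 2 * m ^ 2 + 2 * m ∧
          t 2 = 3 * w + m ^ 2 + 2 * m := by
  decide

/-- hcp letters: every vector of the hcp integer model is a central site. -/
theorem bridgeCore_hcp_labels :
    ∀ t ∈ hcpInt ∪ hcpSecondShellInt, ∃ m ∈ Finset.Icc (-1 : ℤ) 1, ∃ u ∈ Finset.Icc (-2 : ℤ) 2,
      ∃ w ∈ Finset.Icc (-2 : ℤ) 2,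
        t 0 = 3 * u + m ^ 2 + 2 * m ∧ t 1 = -(3 * u) - 3 * w - 2 * m ^ 2 + 2 * m ∧
          t 2 = 3 * w + m ^ 2 + 2 * m := by
  decide

/-! ### Real glue -/

/-- `‖b‖ ≤ 3/2` for a template site `b` reads `12‖b‖² ≤ 27` on the integer `12‖b‖²`. -/
theorem int_le_27_of_norm_le {x : EuclideanSpace ℝ (Fin 3)} {N : ℤ} (hx : 12 * ‖x‖ ^ 2 = (N : ℝ))
    (h : ‖x‖ ≤ 3 / 2) : N ≤ 27 := by
  have h1 : ‖x‖ ^ 2 ≤ (3 / 2) ^ 2 := pow_le_pow_left₀ (norm_nonneg _) h 2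
  have h2 : (N : ℝ) ≤ 27 := by rw [← hx]; nlinarith
  exact_mod_cast h2

/-- `N ≤ 27` forces the layer index into `{-1, 0, 1}`. -/
theorem layer_mem_Icc_of_int_le {u w L m : ℤ}
    (hN : 3 * (2 * u + w + L) ^ 2 + (3 * w + L) ^ 2 + 8 * m ^ 2 ≤ 27) : m ∈ Finset.Icc (-1 : ℤ) 1 := by
  have hm : m ^ 2 < 2 ^ 2 := by nlinarith [sq_nonneg (2 * u + w + L), sq_nonneg (3 * w + L)]
  obtain ⟨h1, h2⟩ := abs_lt_of_sq_lt_sq' hm (by norm_num)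
  exact Finset.mem_Icc.2 ⟨by omega, by omega⟩

/-- fcc letters around layer `0` (`s (-1) = s 0 = 1`): `L m = m` for `|m| ≤ 1`. -/
theorem haggLabel_central_fcc {s : ℤ → ℤ} (hs0 : s 0 = 1) (hs1 : s (-1) = 1) {m : ℤ}
    (hm : m ∈ Finset.Icc (-1 : ℤ) 1) : haggLabel s m = m := by
  obtain ⟨h1, h2⟩ := Finset.mem_Icc.1 hm
  have hp := haggLabel_succ s 0
  have hn := haggLabel_succ s (-1)
  rw [zero_add, haggLabel_zero, zero_add] at hp
  rw [neg_add_cancel, haggLabel_zero] at hn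
  interval_cases m
  · have : haggLabel s (-1) = -s (-1) := by linarith
    simp only [Int.reduceNeg, this, hs1]
  · exact haggLabel_zero s
  · rw [hp, hs0]

/-- hcp letters around layer `0` (`s 0 = 1`, `s (-1) = -1`): `L m = m²` for `|m| ≤ 1`. -/
theorem haggLabel_central_hcp {s : ℤ → ℤ} (hs0 : s 0 = 1) (hs1 : s (-1) = -1) {m : ℤ}
    (hm : m ∈ Finset.Icc (-1 : ℤ) 1) : haggLabel s m = m ^ 2 := by
  obtain ⟨h1, h2⟩ := Finset.mem_Icc.1 hm
  have hp := haggLabel_succ s 0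
  have hn := haggLabel_succ s (-1)
  rw [zero_add, haggLabel_zero, zero_add] at hp
  rw [neg_add_cancel, haggLabel_zero] at hn
  interval_cases m
  · have : haggLabel s (-1) = -s (-1) := by linarith
    simp only [Int.reduceNeg, this, hs1]; norm_num
  · rw [haggLabel_zero]; norm_num
  · rw [hp, hs0]; norm_num

/-- The fcc integer model vector `t` of a central site: `3 • t = barlowSiteInt m u w m`. -/
theorem three_smul_eq_barlowSiteInt {t : Fin 3 → ℤ} {m u w : ℤ}
    (h0 : 3 * t 0 = 3 * u + m + 2 * m) (h1 : 3 * t 1 = -(3 * u) - 3 * w - 2 * m + 2 * m)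
    (h2 : 3 * t 2 = 3 * w + m + 2 * m) : 3 • t = barlowSiteInt m u w m := by
  funext i
  fin_cases i <;> simp [barlowSiteInt] <;> omega

/-- The hcp integer model vector `t` of a central site: `t = barlowSiteInt m u w (m²)`. -/
theorem eq_barlowSiteInt_hcp {t : Fin 3 → ℤ} {m u w : ℤ}
    (h0 : t 0 = 3 * u + m ^ 2 + 2 * m) (h1 : t 1 = -(3 * u) - 3 * w - 2 * m ^ 2 + 2 * m)
    (h2 : t 2 = 3 * w + m ^ 2 + 2 * m) : t = barlowSiteInt m u w (m ^ 2) := by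
  funext i
  fin_cases i <;> simp [barlowSiteInt] <;> omega

/-- The two spellings `√18` and `√(18 : ℕ)` of the model scale agree. -/
theorem sqrt_natCast_eighteen : Real.sqrt ((18 : ℕ) : ℝ) = Real.sqrt 18 := by norm_num

/-! ### Explicit bridge for `s 0 = 1`: the cuboctahedral frame `cuboFrame` -/

/-- **(ii), fcc letters, `s 0 = s (-1) = 1`:** every non-zero template site of norm `≤ 3/2` is carried
by `cuboFrame` into `fccTwoShellPattern`. -/
theorem cuboFrame_barlowPos_mem_fcc {s : ℤ → ℤ} (hs0 : s 0 = 1) (hs1 : s (-1) = 1) {m u w : ℤ}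
    (hle : ‖barlowPos 1 (Real.sqrt 6 / 3) s m u w‖ ≤ 3 / 2)
    (hne : barlowPos 1 (Real.sqrt 6 / 3) s m u w ≠ 0) :
    cuboFrame (barlowPos 1 (Real.sqrt 6 / 3) s m u w) ∈ fccTwoShellPattern := by
  have hN := int_le_27_of_norm_le (chartSites_normSq_eq s m u w) hle
  have hm := layer_mem_Icc_of_int_le hN
  have hL := haggLabel_central_fcc hs0 hs1 hm
  rw [hL] at hN
  obtain ⟨hm1, hm2⟩ := Finset.mem_Icc.1 hm
  obtain ⟨hu, hw⟩ := chartSites_bounds (L := m) ⟨by omega, by omega⟩ (hN.trans (by norm_num))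
  rcases bridgeCore_fcc_sites m hm u hu w hw hN with ⟨rfl, rfl, rfl⟩ | ⟨t, ht, h0, h1, h2⟩
  · exact absurd (by simp [barlowPos]) hne
  · rw [cuboFrame_barlowPos, hL, fccTwoShellPattern_eq_image, sqrt_natCast_eighteen,
      ← three_smul_eq_barlowSiteInt h0 h1 h2]
    exact Finset.mem_image_of_mem _ (Finset.mem_image_of_mem _ ht)

/-- **(i), fcc letters, `s 0 = s (-1) = 1`:** every point of `fccTwoShellPattern` is `cuboFrame` of a
template site of a central layer. -/
theorem exists_site_eq_of_mem_fcc {s : ℤ → ℤ} (hs0 : s 0 = 1) (hs1 : s (-1) = 1)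
    {p : EuclideanSpace ℝ (Fin 3)} (hp : p ∈ fccTwoShellPattern) :
    ∃ m u w : ℤ, m ∈ Finset.Icc (-1 : ℤ) 1 ∧ cuboFrame (barlowPos 1 (Real.sqrt 6 / 3) s m u w) = p := by
  rw [fccTwoShellPattern_eq_image, sqrt_natCast_eighteen] at hp
  obtain ⟨v, hv, rfl⟩ := Finset.mem_image.1 hp
  obtain ⟨t, ht, rfl⟩ := Finset.mem_image.1 hv
  obtain ⟨m, hm, u, -, w, -, h0, h1, h2⟩ := bridgeCore_fcc_labels t ht
  refine ⟨m, u, w, hm, ?_⟩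
  rw [cuboFrame_barlowPos, haggLabel_central_fcc hs0 hs1 hm, ← three_smul_eq_barlowSiteInt h0 h1 h2]

/-- **(ii), hcp letters, `s 0 = 1`, `s (-1) = -1`:** every non-zero template site of norm `≤ 3/2` is
carried by `cuboFrame` into `hcpTwoShellPattern`. -/
theorem cuboFrame_barlowPos_mem_hcp {s : ℤ → ℤ} (hs0 : s 0 = 1) (hs1 : s (-1) = -1) {m u w : ℤ}
    (hle : ‖barlowPos 1 (Real.sqrt 6 / 3) s m u w‖ ≤ 3 / 2)
    (hne : barlowPos 1 (Real.sqrt 6 / 3) s m u w ≠ 0) :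
    cuboFrame (barlowPos 1 (Real.sqrt 6 / 3) s m u w) ∈ hcpTwoShellPattern := by
  have hN := int_le_27_of_norm_le (chartSites_normSq_eq s m u w) hle
  have hm := layer_mem_Icc_of_int_le hN
  have hL := haggLabel_central_hcp hs0 hs1 hm
  rw [hL] at hN
  obtain ⟨hm1, hm2⟩ := Finset.mem_Icc.1 hm
  have hm3 : -2 ≤ m ^ 2 ∧ m ^ 2 ≤ 2 := by constructor <;> nlinarith
  obtain ⟨hu, hw⟩ := chartSites_bounds (L := m ^ 2) hm3 (hN.trans (by norm_num))
  rcases bridgeCore_hcp_sites m hm u hu w hw hN with ⟨rfl, rfl, rfl⟩ | ⟨t, ht, h0, h1, h2⟩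
  · exact absurd (by simp [barlowPos]) hne
  · rw [cuboFrame_barlowPos, hL, hcpTwoShellPattern_eq_image, sqrt_natCast_eighteen,
      ← eq_barlowSiteInt_hcp h0 h1 h2]
    exact Finset.mem_image_of_mem _ ht

/-- **(i), hcp letters, `s 0 = 1`, `s (-1) = -1`:** every point of `hcpTwoShellPattern` is `cuboFrame`
of a template site of a central layer. -/
theorem exists_site_eq_of_mem_hcp {s : ℤ → ℤ} (hs0 : s 0 = 1) (hs1 : s (-1) = -1)
    {p : EuclideanSpace ℝ (Fin 3)} (hp : p ∈ hcpTwoShellPattern) :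
    ∃ m u w : ℤ, m ∈ Finset.Icc (-1 : ℤ) 1 ∧ cuboFrame (barlowPos 1 (Real.sqrt 6 / 3) s m u w) = p := by
  rw [hcpTwoShellPattern_eq_image, sqrt_natCast_eighteen] at hp
  obtain ⟨t, ht, rfl⟩ := Finset.mem_image.1 hp
  obtain ⟨m, hm, u, -, w, -, h0, h1, h2⟩ := bridgeCore_hcp_labels t ht
  refine ⟨m, u, w, hm, ?_⟩
  rw [cuboFrame_barlowPos, haggLabel_central_hcp hs0 hs1 hm, ← eq_barlowSiteInt_hcp h0 h1 h2]

/-! ### Explicit bridge for `s 0 = -1`: the frame `cuboFrame ∘ halfTurn` -/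

/-- Norm and vanishing of a template site are those of the negated word at the half-turned label. -/
theorem norm_barlowPos_neg_seq (s : ℤ → ℤ) (m u w : ℤ) :
    ‖barlowPos 1 (Real.sqrt 6 / 3) (fun k => -s k) m (-u) (-w)‖ = ‖barlowPos 1 (Real.sqrt 6 / 3) s m u w‖ ∧
      (barlowPos 1 (Real.sqrt 6 / 3) (fun k => -s k) m (-u) (-w) = 0 ↔
        barlowPos 1 (Real.sqrt 6 / 3) s m u w = 0) := by
  rw [← halfTurn_barlowPos_eq]
  refine ⟨halfTurn.norm_map _, ?_⟩
  constructor
  · intro h0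
    apply halfTurn.injective
    rw [h0, map_zero]
  · intro h0
    rw [h0, map_zero]

/-- `(cuboFrame ∘ halfTurn)` on a template site is `cuboFrame` of the NEGATED word at the half-turned label. -/
theorem cuboFrame_comp_halfTurn_barlowPos (s : ℤ → ℤ) (m u w : ℤ) :
    (cuboFrame.comp halfTurn.toLinearIsometry) (barlowPos 1 (Real.sqrt 6 / 3) s m u w) =
      cuboFrame (barlowPos 1 (Real.sqrt 6 / 3) (fun k => -s k) m (-u) (-w)) := by
  rw [LinearIsometry.coe_comp, Function.comp_apply, LinearIsometryEquiv.coe_toLinearIsometry,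
    halfTurn_barlowPos_eq]

/-- **(ii), fcc letters, `s 0 = s (-1) = -1`** (frame `cuboFrame ∘ halfTurn`). -/
theorem cuboFrame_halfTurn_barlowPos_mem_fcc {s : ℤ → ℤ} (hs0 : s 0 = -1) (hs1 : s (-1) = -1) {m u w : ℤ}
    (hle : ‖barlowPos 1 (Real.sqrt 6 / 3) s m u w‖ ≤ 3 / 2)
    (hne : barlowPos 1 (Real.sqrt 6 / 3) s m u w ≠ 0) :
    (cuboFrame.comp halfTurn.toLinearIsometry) (barlowPos 1 (Real.sqrt 6 / 3) s m u w) ∈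
      fccTwoShellPattern := by
  obtain ⟨hn, hz⟩ := norm_barlowPos_neg_seq s m u w
  rw [cuboFrame_comp_halfTurn_barlowPos]
  exact cuboFrame_barlowPos_mem_fcc (s := fun k => -s k) (by simp [hs0]) (by simp [hs1]) (hn.symm ▸ hle)
    (fun h' => hne (hz.1 h'))

/-- **(i), fcc letters, `s 0 = s (-1) = -1`** (frame `cuboFrame ∘ halfTurn`). -/
theorem exists_site_halfTurn_eq_of_mem_fcc {s : ℤ → ℤ} (hs0 : s 0 = -1) (hs1 : s (-1) = -1)
    {p : EuclideanSpace ℝ (Fin 3)} (hp : p ∈ fccTwoShellPattern) :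
    ∃ m u w : ℤ, m ∈ Finset.Icc (-1 : ℤ) 1 ∧
      (cuboFrame.comp halfTurn.toLinearIsometry) (barlowPos 1 (Real.sqrt 6 / 3) s m u w) = p := by
  obtain ⟨m, u, w, hm, h⟩ := exists_site_eq_of_mem_fcc (s := fun k => -s k) (by simp [hs0]) (by simp [hs1]) hp
  exact ⟨m, -u, -w, hm, by rw [cuboFrame_comp_halfTurn_barlowPos, neg_neg, neg_neg, h]⟩

/-- **(ii), hcp letters, `s 0 = -1`, `s (-1) = 1`** (frame `cuboFrame ∘ halfTurn`). -/
theorem cuboFrame_halfTurn_barlowPos_mem_hcp {s : ℤ → ℤ} (hs0 : s 0 = -1) (hs1 : s (-1) = 1) {m u w : ℤ}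
    (hle : ‖barlowPos 1 (Real.sqrt 6 / 3) s m u w‖ ≤ 3 / 2)
    (hne : barlowPos 1 (Real.sqrt 6 / 3) s m u w ≠ 0) :
    (cuboFrame.comp halfTurn.toLinearIsometry) (barlowPos 1 (Real.sqrt 6 / 3) s m u w) ∈
      hcpTwoShellPattern := by
  obtain ⟨hn, hz⟩ := norm_barlowPos_neg_seq s m u w
  rw [cuboFrame_comp_halfTurn_barlowPos]
  exact cuboFrame_barlowPos_mem_hcp (s := fun k => -s k) (by simp [hs0]) (by simp [hs1]) (hn.symm ▸ hle)
    (fun h' => hne (hz.1 h'))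

/-- **(i), hcp letters, `s 0 = -1`, `s (-1) = 1`** (frame `cuboFrame ∘ halfTurn`). -/
theorem exists_site_halfTurn_eq_of_mem_hcp {s : ℤ → ℤ} (hs0 : s 0 = -1) (hs1 : s (-1) = 1)
    {p : EuclideanSpace ℝ (Fin 3)} (hp : p ∈ hcpTwoShellPattern) :
    ∃ m u w : ℤ, m ∈ Finset.Icc (-1 : ℤ) 1 ∧
      (cuboFrame.comp halfTurn.toLinearIsometry) (barlowPos 1 (Real.sqrt 6 / 3) s m u w) = p := by
  obtain ⟨m, u, w, hm, h⟩ := exists_site_eq_of_mem_hcp (s := fun k => -s k) (by simp [hs0]) (by simp [hs1]) hp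
  exact ⟨m, -u, -w, hm, by rw [cuboFrame_comp_halfTurn_barlowPos, neg_neg, neg_neg, h]⟩

/-! ### The bridge for every Hägg word -/

/-- **The bridge, fcc type** (clauses (i) and (ii) of `stub_chartCore` for `P = fccTwoShellPattern`): for a
Hägg word whose letters below and above layer `0` agree there is a linear isometry (`cuboFrame` if
`s 0 = 1`, `cuboFrame ∘ halfTurn` if `s 0 = -1`) carrying the non-zero template sites of norm `≤ 3/2` into the
fcc two-shell pattern, and onto it. -/
theorem chartCoreBridge_fcc {s : ℤ → ℤ} (hs : IsHaggSeq s) (h : s (-1) = s 0) :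
    ∃ R : EuclideanSpace ℝ (Fin 3) →ₗᵢ[ℝ] EuclideanSpace ℝ (Fin 3),
      (∀ v ∈ fccTwoShellPattern, ∃ m u w : ℤ, R (barlowPos 1 (Real.sqrt 6 / 3) s m u w) = v) ∧
      (∀ m u w : ℤ, ‖barlowPos 1 (Real.sqrt 6 / 3) s m u w‖ ≤ 3 / 2 →
        barlowPos 1 (Real.sqrt 6 / 3) s m u w ≠ 0 →
        R (barlowPos 1 (Real.sqrt 6 / 3) s m u w) ∈ fccTwoShellPattern) := by
  rcases hs 0 with h0 | h0
  · refine ⟨cuboFrame, fun v hv => ?_, fun m u w hle hne => ?_⟩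
    · obtain ⟨m, u, w, -, hm⟩ := exists_site_eq_of_mem_fcc h0 (h.trans h0) hv
      exact ⟨m, u, w, hm⟩
    · exact cuboFrame_barlowPos_mem_fcc h0 (h.trans h0) hle hne
  · refine ⟨cuboFrame.comp halfTurn.toLinearIsometry, fun v hv => ?_, fun m u w hle hne => ?_⟩
    · obtain ⟨m, u, w, -, hm⟩ := exists_site_halfTurn_eq_of_mem_fcc h0 (h.trans h0) hv
      exact ⟨m, u, w, hm⟩
    · exact cuboFrame_halfTurn_barlowPos_mem_fcc h0 (h.trans h0) hle hne

/-- **The bridge, hcp type** (clauses (i) and (ii) of `stub_chartCore` for `P = hcpTwoShellPattern`): for a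
Hägg word whose letters below and above layer `0` differ there is a linear isometry (`cuboFrame` if
`s 0 = 1`, `cuboFrame ∘ halfTurn` if `s 0 = -1`) carrying the non-zero template sites of norm `≤ 3/2` into the
hcp two-shell pattern, and onto it. -/
theorem chartCoreBridge_hcp {s : ℤ → ℤ} (hs : IsHaggSeq s) (h : s (-1) ≠ s 0) :
    ∃ R : EuclideanSpace ℝ (Fin 3) →ₗᵢ[ℝ] EuclideanSpace ℝ (Fin 3),
      (∀ v ∈ hcpTwoShellPattern, ∃ m u w : ℤ, R (barlowPos 1 (Real.sqrt 6 / 3) s m u w) = v) ∧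
      (∀ m u w : ℤ, ‖barlowPos 1 (Real.sqrt 6 / 3) s m u w‖ ≤ 3 / 2 →
        barlowPos 1 (Real.sqrt 6 / 3) s m u w ≠ 0 →
        R (barlowPos 1 (Real.sqrt 6 / 3) s m u w) ∈ hcpTwoShellPattern) := by
  have h1 : s (-1) = -s 0 := by
    rcases hs 0 with h0 | h0 <;> rcases hs (-1) with h1 | h1 <;> omega
  rcases hs 0 with h0 | h0
  · have h1' : s (-1) = -1 := by rw [h1, h0]
    refine ⟨cuboFrame, fun v hv => ?_, fun m u w hle hne => ?_⟩
    · obtain ⟨m, u, w, -, hm⟩ := exists_site_eq_of_mem_hcp h0 h1' hv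
      exact ⟨m, u, w, hm⟩
    · exact cuboFrame_barlowPos_mem_hcp h0 h1' hle hne
  · have h1' : s (-1) = 1 := by rw [h1, h0]; rfl
    refine ⟨cuboFrame.comp halfTurn.toLinearIsometry, fun v hv => ?_, fun m u w hle hne => ?_⟩
    · obtain ⟨m, u, w, -, hm⟩ := exists_site_halfTurn_eq_of_mem_hcp h0 h1' hv
      exact ⟨m, u, w, hm⟩
    · exact cuboFrame_halfTurn_barlowPos_mem_hcp h0 h1' hle hne

/-- **Clauses (i)+(ii) of `stub_chartCore` for the witnessed pattern** (`P = fcc ∨ P = hcp`): choosing the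
word type by the pattern — any Hägg word with `s (-1) = s 0` for fcc, `s (-1) ≠ s 0` for hcp — some linear
isometry realises `P` exactly as the image of the non-zero central template sites. -/
theorem chartCoreBridge {P : Finset (EuclideanSpace ℝ (Fin 3))} {s : ℤ → ℤ} (hs : IsHaggSeq s)
    (hP : (P = fccTwoShellPattern ∧ s (-1) = s 0) ∨ (P = hcpTwoShellPattern ∧ s (-1) ≠ s 0)) :
    ∃ R : EuclideanSpace ℝ (Fin 3) →ₗᵢ[ℝ] EuclideanSpace ℝ (Fin 3),
      (∀ v ∈ P, ∃ m u w : ℤ, R (barlowPos 1 (Real.sqrt 6 / 3) s m u w) = v) ∧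
      (∀ m u w : ℤ, ‖barlowPos 1 (Real.sqrt 6 / 3) s m u w‖ ≤ 3 / 2 →
        barlowPos 1 (Real.sqrt 6 / 3) s m u w ≠ 0 →
        R (barlowPos 1 (Real.sqrt 6 / 3) s m u w) ∈ P) := by
  rcases hP with ⟨rfl, h⟩ | ⟨rfl, h⟩
  · exact chartCoreBridge_fcc hs h
  · exact chartCoreBridge_hcp hs h

/-- **The two canonical words.**  For the witnessed pattern `P` of a good particle, the word `constHagg`
(fcc, `ABCABC…`) resp. `alternatingHagg` (hcp, `ABAB…`) with the frame `cuboFrame` satisfies clauses (i) and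
(ii) of `stub_chartCore`. -/
theorem chartCoreBridge_canonical {P : Finset (EuclideanSpace ℝ (Fin 3))}
    (hP : P = fccTwoShellPattern ∨ P = hcpTwoShellPattern) :
    ∃ s : ℤ → ℤ, IsHaggSeq s ∧ (s = constHagg ∨ s = alternatingHagg) ∧
      (∀ v ∈ P, ∃ m u w : ℤ, cuboFrame (barlowPos 1 (Real.sqrt 6 / 3) s m u w) = v) ∧
      (∀ m u w : ℤ, ‖barlowPos 1 (Real.sqrt 6 / 3) s m u w‖ ≤ 3 / 2 →
        barlowPos 1 (Real.sqrt 6 / 3) s m u w ≠ 0 →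
        cuboFrame (barlowPos 1 (Real.sqrt 6 / 3) s m u w) ∈ P) := by
  rcases hP with rfl | rfl
  · refine ⟨constHagg, isHaggSeq_const, Or.inl rfl, fun v hv => ?_, fun m u w hle hne => ?_⟩
    · obtain ⟨m, u, w, -, hm⟩ := exists_site_eq_of_mem_fcc (s := constHagg) rfl rfl hv
      exact ⟨m, u, w, hm⟩
    · exact cuboFrame_barlowPos_mem_fcc rfl rfl hle hne
  · have h0 : alternatingHagg 0 = 1 := by simp [alternatingHagg]
    have h1 : alternatingHagg (-1) = -1 := by decide
    refine ⟨alternatingHagg, isHaggSeq_alternating, Or.inr rfl, fun v hv => ?_, fun m u w hle hne => ?_⟩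
    · obtain ⟨m, u, w, -, hm⟩ := exists_site_eq_of_mem_hcp h0 h1 hv
      exact ⟨m, u, w, hm⟩
    · exact cuboFrame_barlowPos_mem_hcp h0 h1 hle hne

/-- **Registered sub-goal `stub_chartCoreBridge` of crux stmt-AtomisticToContinuum-16827** (clauses (i)+(ii) of
`stub_chartCore`, the pattern–template bridge, for every Hägg word of the right type): landing anchor of this
file, re-exporting `chartCoreBridge`. -/
theorem stub_chartCoreBridge : ∀ (P : Finset (EuclideanSpace ℝ (Fin 3))) (s : ℤ → ℤ), IsHaggSeq s → ((P = fccTwoShellPattern ∧ s (-1) = s 0) ∨ (P = hcpTwoShellPattern ∧ s (-1) ≠ s 0)) → ∃ R : EuclideanSpace ℝ (Fin 3) →ₗᵢ[ℝ] EuclideanSpace ℝ (Fin 3), (∀ v ∈ P, ∃ m u w : ℤ, R (barlowPos 1 (Real.sqrt 6 / 3) s m u w) = v) ∧ (∀ m u w : ℤ, ‖barlowPos 1 (Real.sqrt 6 / 3) s m u w‖ ≤ 3 / 2 → barlowPos 1 (Real.sqrt 6 / 3) s m u w ≠ 0 → R (barlowPos 1 (Real.sqrt 6 / 3) s m u w)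 ∈ P) :=
  fun _ _ hs hP => chartCoreBridge hs hP

end Summit.AtomisticToContinuum.Crystallization.Theorems.NashClassCertificatesNashNearField

end
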